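import Summits.QuantumFields.BalabanUV.T4Continuum.Support.NE3DecomposedRepOfShapes
import Summits.QuantumFields.BalabanUV.T4Continuum.Support.NE3EnergyRateWSupOfEndpointChart
import HarnessLib

/-!
# T⁴ programme, node NE3 — route Π, file 6a: `DecomposedRep` OVER `sfClass` AT A REGULAR MINIMISER PAIR FROM THE TWO TYPED LEAVES AND THE
# LETTERS OF THE LINEAR NORMAL PART — every class∕window∕fibre datum of the junction DISCHARGED from the class, the sizes DOMINATED by
# k-FREE CURRENCIES

NE3 (node U1b), row NE3 OWNER `b2b-balaban-t4-ne3-p1` (gen 26; ONLINE journal l.24333, item (2)); design `D-ne3p1-g25-1.md` §4, g25 HANDOFF «file 6».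
Inputs BY NAME: the junction `NE3DecomposedRepOfShapes.decomposedRep_of_shapes` (file 4, p242094) with its shapes `ResidualSliceRepT` (file 2) and
`LocalSupMajorantBall` (file 4); file 1 `NE3ResidualSliceRep` (`mem_sfClass_gaugeAct`, `mem_admissible_gaugeAct`); the class transport
`MinimalActionRate.rescale_bavg_mem_sfClass` and `NE3EnergyRateWSupOfEndpointChart.cavg_mem_admissible_sfClass`; Π-C-1
`NE3LinearisedAverageSup.curvSum_le_of_levelSmall`; `GaugeFieldPerturbation.norm_fhol_sub_one_le_of_smallField`.

WHAT.  At level `j+1` of `sfClass d L N ε` with `U_A` a minimiser of run `j+1`, `U_B` a minimiser of run `j+2` regular with data `(b, g)`, and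
`W := cavg L U_B`: §1 the BACKGROUND DATA of the junction are theorems over the class — `W ∈ sfClass (j+1)` (unitary, `(L^{j+1}·N)`-periodic, small
field of radius `x_j = ε∕(L^{j+1})²`), `W` admissible for run `j+1`, `curvSum d L (j+1) x_j ≤ (2∕3)L` from Π-C-1 and ONE k-free line
`(17∕12)·curv d L (ε∕L²) ≤ (2∕3)L`, the multi-level smallness from the class family `hsm1 : ∀ j, LevelSmall d L (j+1) (ε∕(L^{j+1})²)` (one notch down by
`NE3FramePotBoundW.levelSmall_pred`); the FIBRE
EQUATION `cavgIter L (j+1) (W·e^{X₀}) = cavgIter L (j+1) W` for any R-adapted residual slice representative (its gauge is corner-trivial, `U_A` and `W`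
are admissible); the WINDOW RADII `xW = xA = x_j` (`U_A^u ∈ sfClass` by gauge invariance).  §2 k-free domination arithmetic.  §3
**`decomposedRep_sfClass_of_leaves`**: given the two leaves `ResidualSliceRepT L N (j+1) W U_A u X₀ Nn α₀`, `LocalSupMajorantBall L N (j+1) X₀ m C`
(`m ≤ α₀`), the letters of the linear normal part `Nn` (periodic; sup `αN`; window sup-curl `aN`; (R1)–(R4) against `φ := dirIter L (j+1) W X₀` with
constants `c₁..c₄` — `Nn` is MEANT to be Π-R-W's `rightInvW … φ`, generic here), and k-FREE CURRENCIES `α₀·L^{j+1} ≤ α̂`, `C ≤ Ĉ`, `αN·L^{j+1} ≤ α̂N`,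
`aN·(L^{j+1})² ≤ âN` under FIVE uniform numeric lines, the pair carries a `DecomposedRep` whose sizes are dominated by the UNIFORM letters
`ν̄ = (1+2048√(16d+1))·2√(c₁+c₂)·C₂·Ĉ·α̂`, `κ̄₁ = (4c₃ + 32768·d·c₄)·C₂·Ĉ²·â`, `κ̄₂ = 7224·c₄·C₂·Ĉ²·â` (`C₂ = 4(3+12d)³∕rho0²`,
`â = 3ε + 2âN + 8192(α̂+α̂N)α̂N + 48α̂² + 1300((α̂+α̂N) + (1+2048(α̂+α̂N))α̂N)²`), with sup data `≤ 1∕40`, `≤ 1∕100` and the level lines (J1)(J2) from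
the two uniform lines `(1 + 480√d·(α̂ + 24α̂N))² + 48·d·â ≤ Λ`, `112·d·â·CP ≤ 1∕(2·card n)` — EXACTLY the per-pair input of file 5b's
`NE3ChartLettersMono.hchart_uniform_of_decomposedRep`.

HONEST FRAMING.  Bookkeeping and elementary real arithmetic over landed theorems; the two leaves, the letters of `Nn` and the numeric lines are
HYPOTHESES (suppliers: Π-L1♮ and (Π-REG) are TYPED LEAVES of route Π — B11 Prop 2 ∕ B11 regularity TYPE, ours in form; Π-R-W W5∕W6 for the letters);
(P♮)_W's numeric lines, (H∃), T-E_w♯ and NE3 are NOT proved; spine PROVED 0∕9; finite T⁴ rung (B)+1 — NOT infinite volume, NOT mass gap, NOT `BetaPertH`,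
NOT Clay.  PLACEMENT: `Summits/QuantumFields/BalabanUV/`.  HONEST DEPENDENCY: continuum YM on T⁴ ⇐ BetaPertH ∧ nine spine estimates (0/9 proved);
BetaPertH ⇐ (D1) ∧ (D4) ∧ CAP+tail; G-an2-4 gates asym, D1 and NE2/3/4.
-/

set_option autoImplicit false

open scoped BigOperators Matrix.Norms.L2Operator
open NormedSpace Finset

namespace Summit.QuantumFields.BalabanUV.T4Continuum.NE3DecomposedRepSfClass

open Set
open Literature.MathematicalPhysics.QuantumFieldTheory.Balaban1983to89
open B7Prop1Explicit B7Prop2Explicit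
open T4AveragingDeficitWall (IsSkewDir IsUnitaryCfg SmallField vary curl curlSq dirSq dirL1 fhol)
open T4AveragingDeficitWallBoundary (IsPeriodicCfg periodBox)
open AveragingDeficitPeriodicCounting (IsPeriodicDir)
open AveragingDeficitChartCalculus (cavg)
open AveragingDeficitMultiLevelPrep (cavgIter LevelSmall)
open AveragingDeficitMultiLevelBridge (cavgIter_eq_avgIter)
open BlockAverageVaryDisc (rho0 rho0_pos)
open MinimalActionLevels (perWin)
open MinimalActionSandwich (IsMinimiser admissible)
open MinimalActionRate (sfClass Regular rescale_bavg_mem_sfClass)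
open NE3TangentCovariantTower (dirIter)
open NE3LinearisedAverageSup (curv curvSum curvSum_le_of_levelSmall)
open NE3FramePotBoundW (levelSmall_pred)
open NE3EnergyWeightedShapes (energyNormW)
open NE3FrameFreeSliceW (frameFreeBlockLandauW)
open NE3ProductPathChart (DecomposedRep)
open NE3ResidualSliceRep (normalPart mem_sfClass_gaugeAct mem_admissible_gaugeAct)
open NE3DecomposedRepOfLinearNormalPart (ResidualSliceRepT)
open NE3DecomposedRepOfShapes (LocalSupMajorantBall decomposedRep_of_shapes)
open NE3EnergyRateWSupOfEndpointChart (cavg_mem_admissible_sfClass)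
open GaugeFieldPerturbation (norm_fhol_sub_one_le_of_smallField)

noncomputable section

variable {d : ℕ} {n : Type*} [Fintype n] [DecidableEq n]

/-! ## §1 Background data, fibre equation and window radii over the class -/

/-- The level radius `x_j = ε∕(L^{j+1})²` rescaled: `((L²)^j)·x_j = ε∕L²` and `(L^{j+1})²·x_j = ε`. [folklore] -/
theorem levelRadius_rescale {L : ℕ} (hL : 1 ≤ L) (ε : ℝ) (j : ℕ) :
    ((L : ℝ) ^ 2) ^ j * (ε / ((L : ℝ) ^ (j + 1)) ^ 2) = ε / (L : ℝ) ^ 2 ∧ ((L : ℝ) ^ (j + 1)) ^ 2 * (ε / ((L : ℝ) ^ (j + 1)) ^ 2) = ε := by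
  have hL0 : (0 : ℝ) < L := by exact_mod_cast (show 0 < L by omega)
  have hLj : (0 : ℝ) < (L : ℝ) ^ (j + 1) := by positivity
  constructor
  · rw [pow_succ]; field_simp; ring
  · field_simp

/-- **THE BACKGROUND DATA OF THE JUNCTION OVER `sfClass`** at a run-`j+2` admissible regular `U_B`: `W = cavg L U_B` is unitary, `(L^{j+1}·N)`-periodic,
a small field of radius `x_j = ε∕(L^{j+1})²`, admissible for run `j+1`, with plaquette variables within `x_j` of `1` on the period window, and — under the
class family `hsm1` and the k-free line `hcurv` — `curvSum d L (j+1) x_j ≤ (2∕3)L`. [folklore] -/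
theorem background_data [Nonempty n] {L N : ℕ} (hL : 2 ≤ L) {ε b g : ℝ} (hb : 0 ≤ b) (hε : 0 ≤ ε)
    (hbs : 512 * (d + 1) * (d + 4) * (L : ℝ) ^ 2 * b ≤ 1) (hbε' : b + 226 * (8 * (d + 1) * (d + 4)) ^ 2 * b ^ 2 ≤ ε)
    (hsm1 : ∀ j : ℕ, LevelSmall d L (j + 1) (ε / ((L : ℝ) ^ (j + 1)) ^ 2)) (hcurv : 17 / 12 * curv d L (ε / (L : ℝ) ^ 2) ≤ 2 / 3 * L)
    (j : ℕ) {V UB : Site d → Fin d → (Matrix n n ℂ)ˣ} (hB : UB ∈ admissible (sfClass d L N ε) L (j + 2) V) (hreg : Regular d L N b g (j + 2) UB) :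
    cavg L UB ∈ sfClass d L N ε (j + 1) ∧ IsUnitaryCfg (cavg L UB) ∧ IsPeriodicCfg (cavg L UB) ((L ^ (j + 1) * N : ℕ) : ℤ) ∧
      SmallField (cavg L UB) (ε / ((L : ℝ) ^ (j + 1)) ^ 2) ∧ LevelSmall d L (j + 1) (ε / ((L : ℝ) ^ (j + 1)) ^ 2) ∧
      LevelSmall d L j (ε / ((L : ℝ) ^ (j + 1)) ^ 2) ∧ curvSum d L (j + 1) (ε / ((L : ℝ) ^ (j + 1)) ^ 2) ≤ 2 / 3 * L ∧
      cavg L UB ∈ admissible (sfClass d L N ε) L (j + 1) V ∧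
      (∀ p ∈ perWin d (N * L ^ (j + 1)), ‖((fhol (cavg L UB) p : (Matrix n n ℂ)ˣ) : Matrix n n ℂ) - 1‖ ≤ ε / ((L : ℝ) ^ (j + 1)) ^ 2) := by
  have hL1 : 1 ≤ L := by omega
  have hcl : cavg L UB ∈ sfClass d L N ε (j + 1) := rescale_bavg_mem_sfClass hL1 hb hbs hbε' hreg
  obtain ⟨hWu, hWP, hWx⟩ := hcl
  have hWP' : IsPeriodicCfg (cavg L UB) ((L ^ (j + 1) * N : ℕ) : ℤ) := by rw [Nat.mul_comm]; exact hWP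
  have hx : 0 ≤ ε / ((L : ℝ) ^ (j + 1)) ^ 2 := by positivity
  have hsm : LevelSmall d L (j + 1) (ε / ((L : ℝ) ^ (j + 1)) ^ 2) := hsm1 j
  have hsmj : LevelSmall d L j (ε / ((L : ℝ) ^ (j + 1)) ^ 2) := levelSmall_pred j hsm
  have hA : curvSum d L (j + 1) (ε / ((L : ℝ) ^ (j + 1)) ^ 2) ≤ 2 / 3 * L := by
    have h1 := curvSum_le_of_levelSmall (d := d) hL j hx hsmj
    rw [(levelRadius_rescale hL1 ε j).1] at h1
    exact h1.trans hcurv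
  have hadm : cavg L UB ∈ admissible (sfClass d L N ε) L (j + 1) V := cavg_mem_admissible_sfClass hL1 hb hbs hbε' hB hreg
  exact ⟨⟨hWu, hWP, hWx⟩, hWu, hWP', hWx, hsm, hsmj, hA, hadm, fun p _ => norm_fhol_sub_one_le_of_smallField hWx p⟩

/-- **THE FIBRE EQUATION AND THE WINDOW RADIUS OF `U_A^u`** for an R-adapted residual slice representative over `sfClass`: the corner-trivial gauge keeps
admissibility EXACTLY, so `cavgIter L (j+1) (W·e^{X₀}) = V = cavgIter L (j+1) W`, and `U_A^u = W·e^{X₀} ∈ sfClass (j+1)` has plaquette variables within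
`x_j` of `1`. [folklore] -/
theorem fibre_and_window [Nonempty n] {L N : ℕ} (hL : 1 ≤ L) {ε : ℝ} (j : ℕ) (hε : 0 ≤ ε)
    (hs : LevelSmall d L j (ε / ((L : ℝ) ^ (j + 1)) ^ 2)) {V UA W : Site d → Fin d → (Matrix n n ℂ)ˣ}
    (hA : UA ∈ admissible (sfClass d L N ε) L (j + 1) V) (hW : W ∈ admissible (sfClass d L N ε) L (j + 1) V)
    {u : Site d → (Matrix n n ℂ)ˣ} {X₀ Nn : Site d → Fin d → Matrix n n ℂ} {α₀ : ℝ} (h : ResidualSliceRepT L N (j + 1) W UA u X₀ Nn α₀) :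
    cavgIter L (j + 1) (vary W X₀ 1) = cavgIter L (j + 1) W ∧
      ∀ p ∈ perWin d (N * L ^ (j + 1)), ‖((fhol (vary W X₀ 1) p : (Matrix n n ℂ)ˣ) : Matrix n n ℂ) - 1‖ ≤ ε / ((L : ℝ) ^ (j + 1)) ^ 2 := by
  have h1 := mem_admissible_gaugeAct hL j hε hs hA h.gauge.1 h.gauge.2 h.cornerTrivial
  rw [h.rep] at h1
  have h2 : cavgIter L (j + 1) (vary W X₀ 1) = V := by rw [cavgIter_eq_avgIter]; exact h1.2
  have h3 : cavgIter L (j + 1) W = V := by rw [cavgIter_eq_avgIter]; exact hW.2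
  exact ⟨h2.trans h3.symm, fun p _ => norm_fhol_sub_one_le_of_smallField h1.1.2.2 p⟩

/-! ## §2 k-free domination arithmetic -/

/-- `K·C·s ≤ K·Ĉ·ŝ` for `0 ≤ K`, `0 ≤ C ≤ Ĉ`, `0 ≤ s ≤ ŝ`. [folklore] -/
theorem dom_three {K C Cb s sb : ℝ} (hK : 0 ≤ K) (hC0 : 0 ≤ C) (hC : C ≤ Cb) (hs0 : 0 ≤ s) (hs : s ≤ sb) :
    K * C * s ≤ K * Cb * sb := by
  have h1 : C * s ≤ Cb * sb := mul_le_mul hC hs hs0 (hC0.trans hC)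
  have := mul_le_mul_of_nonneg_left h1 hK
  linarith [mul_assoc K C s, mul_assoc K Cb sb, this]

/-- **THE PLAQUETTE RADIUS IN k-FREE CURRENCIES**: `a·M² ≤ â` for the junction's radius
`a = 2x + x + 2aN + 4(2048(α₀+αN)αN) + 48α₀² + 1300((α₀+αN) + (1+2048(α₀+αN))αN)²` when `x·M² = ε`, `aN·M² ≤ âN`, `α₀M ≤ α̂`, `αN·M ≤ α̂N`, `1 ≤ M`.
[folklore] -/
theorem radius_dom {x aN α₀ αN M ε aNh αh αNh : ℝ} (hM : 1 ≤ M) (hα₀ : 0 ≤ α₀) (hαN : 0 ≤ αN)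
    (hx : M ^ 2 * x = ε) (haN : aN * M ^ 2 ≤ aNh) (hα : α₀ * M ≤ αh) (hN : αN * M ≤ αNh) :
    (2 * x + x + 2 * aN + 4 * (2048 * (α₀ + αN) * αN) + 48 * α₀ ^ 2 + 1300 * ((α₀ + αN) + (1 + 2048 * (α₀ + αN)) * αN) ^ 2) * M ^ 2
      ≤ 3 * ε + 2 * aNh + 8192 * (αh + αNh) * αNh + 48 * αh ^ 2 + 1300 * ((αh + αNh) + (1 + 2048 * (αh + αNh)) * αNh) ^ 2 := by
  have hM0 : 0 ≤ M := by linarith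
  have hαh0 : 0 ≤ αh := le_trans (by positivity) hα
  have hαNh0 : 0 ≤ αNh := le_trans (by positivity) hN
  -- the currencies dominate the bare data too (`M ≥ 1`)
  have hα' : α₀ ≤ αh := le_trans (by nlinarith) hα
  have hN' : αN ≤ αNh := le_trans (by nlinarith) hN
  -- products carrying one `M` each
  have hsM : (α₀ + αN) * M ≤ αh + αNh := by nlinarith
  have hs0 : 0 ≤ (α₀ + αN) * M := by positivity
  have h1 : (α₀ + αN) * αN * M ^ 2 ≤ (αh + αNh) * αNh := by
    have := mul_le_mul hsM hN (by positivity) (by positivity)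
    nlinarith [this]
  have h2 : α₀ ^ 2 * M ^ 2 ≤ αh ^ 2 := by
    have h := mul_le_mul hα hα (by positivity) hαh0
    nlinarith [h]
  have h3 : ((α₀ + αN) + (1 + 2048 * (α₀ + αN)) * αN) * M ≤ (αh + αNh) + (1 + 2048 * (αh + αNh)) * αNh := by
    have hf : 1 + 2048 * (α₀ + αN) ≤ 1 + 2048 * (αh + αNh) := by linarith
    have hf0 : 0 ≤ 1 + 2048 * (α₀ + αN) := by positivity
    have hp : (1 + 2048 * (α₀ + αN)) * (αN * M) ≤ (1 + 2048 * (αh + αNh)) * αNh := mul_le_mul hf hN (by positivity) (by positivity)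
    nlinarith [hp, hsM]
  have h30 : 0 ≤ ((α₀ + αN) + (1 + 2048 * (α₀ + αN)) * αN) * M := by positivity
  have h4 : ((α₀ + αN) + (1 + 2048 * (α₀ + αN)) * αN) ^ 2 * M ^ 2 ≤ ((αh + αNh) + (1 + 2048 * (αh + αNh)) * αNh) ^ 2 := by
    have h := mul_le_mul h3 h3 h30 (h30.trans h3)
    nlinarith [h]
  nlinarith [h1, h2, h4, haN, hx]

/-- `e^{10s} − 1 ≤ 20s` for `0 ≤ s`, `10s ≤ 1`; hence the (J1) bracket `(e^{10s} − 1)·M ≤ 20ŝ` when `sM ≤ ŝ`, `10ŝ ≤ 1`, `1 ≤ M`. [folklore] -/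
theorem exp_bracket_dom {s M sh : ℝ} (hM : 1 ≤ M) (hs0 : 0 ≤ s) (hsM : s * M ≤ sh) (hsh : 10 * sh ≤ 1) :
    (Real.exp (10 * s) - 1) * M ≤ 20 * sh := by
  have hs : s ≤ sh := le_trans (by nlinarith) hsM
  have h10 : |10 * s| ≤ 1 := by rw [abs_of_nonneg (by positivity)]; linarith
  have h1 : Real.exp (10 * s) - 1 ≤ 2 * (10 * s) := by
    have h := Real.abs_exp_sub_one_le h10
    rw [abs_of_nonneg (by positivity : (0:ℝ) ≤ 10 * s)] at h
    exact (le_abs_self _).trans h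
  have h0 : 0 ≤ Real.exp (10 * s) - 1 := by
    have := Real.one_le_exp (by positivity : (0:ℝ) ≤ 10 * s)
    linarith
  calc (Real.exp (10 * s) - 1) * M ≤ 2 * (10 * s) * M := mul_le_mul_of_nonneg_right h1 (by linarith)
    _ = 20 * (s * M) := by ring
    _ ≤ 20 * sh := by linarith

/-! ## §3 `DecomposedRep` over `sfClass` from the two leaves, sizes dominated by uniform letters -/

/-- **`DecomposedRep` OVER `sfClass` AT A REGULAR MINIMISER PAIR FROM THE TWO TYPED LEAVES OF ROUTE Π, WITH UNIFORMLY DOMINATED SIZES.**  See the module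
docstring: every class∕window∕fibre datum of the junction is discharged from the class; what is displayed per pair is the two leaves, the letters of the
linear normal part `Nn`, and four k-free currencies; the numeric lines are uniform.  The conclusion is EXACTLY the per-pair clause of file 5b's
`NE3ChartLettersMono.hchart_uniform_of_decomposedRep`. [folklore] -/
theorem decomposedRep_sfClass_of_leaves [Nonempty n] {L N : ℕ} [NeZero N] (hL : 2 ≤ L) (hN : 1 ≤ N) {ε b g : ℝ} (hb : 0 ≤ b)
    (hε : 0 ≤ ε) (hbs : 512 * (d + 1) * (d + 4) * (L : ℝ) ^ 2 * b ≤ 1) (hbε' : b + 226 * (8 * (d + 1) * (d + 4)) ^ 2 * b ^ 2 ≤ ε)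
    (hsm1 : ∀ j : ℕ, LevelSmall d L (j + 1) (ε / ((L : ℝ) ^ (j + 1)) ^ 2)) (hcurv : 17 / 12 * curv d L (ε / (L : ℝ) ^ 2) ≤ 2 / 3 * L)
    -- the pair
    (j : ℕ) {V UA UB : Site d → Fin d → (Matrix n n ℂ)ˣ} (hUA : IsMinimiser d (sfClass d L N ε) L N (j + 1) V UA)
    (hUB : IsMinimiser d (sfClass d L N ε) L N (j + 2) V UB) (hreg : Regular d L N b g (j + 2) UB)
    -- the two leaves at the pair
    {u : Site d → (Matrix n n ℂ)ˣ} {X₀ Nn : Site d → Fin d → Matrix n n ℂ} {α₀ : ℝ}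
    (h : ResidualSliceRepT L N (j + 1) (cavg L UB) UA u X₀ Nn α₀)
    {m : Site d → Fin d → ℝ} {C : ℝ} (hm : LocalSupMajorantBall L N (j + 1) X₀ m C) (hmα : ∀ z κ, m z κ ≤ α₀)
    -- the letters of the linear normal part against `φ := dirIter L (j+1) W X₀`
    {αN aN c₁ c₂ c₃ c₄ : ℝ} (hNP : IsPeriodicDir Nn ((N * L ^ (j + 1) : ℕ) : ℤ)) (hαN0 : 0 ≤ αN) (hNsup : ∀ y μ, ‖Nn y μ‖ ≤ αN)
    (haN0 : 0 ≤ aN) (haN : ∀ p ∈ perWin d (N * L ^ (j + 1)), ‖curl (cavg L UB) Nn p‖ ≤ aN)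
    (hc₁ : 0 ≤ c₁) (hc₂ : 0 ≤ c₂) (hc₃ : 0 ≤ c₃) (hc₄ : 0 ≤ c₄)
    (hR1 : dirSq Nn (periodBox (d := d) (N * L ^ (j + 1)))
      ≤ c₁ * (((L : ℝ) ^ (j + 1)) ^ d / ((L : ℝ) ^ (j + 1)) ^ 2) * dirSq (dirIter L (j + 1) (cavg L UB) X₀) (periodBox (d := d) N))
    (hR2 : curlSq (cavg L UB) Nn (periodBox (d := d) (N * L ^ (j + 1)))
      ≤ c₂ * (((L : ℝ) ^ (j + 1)) ^ d / ((L : ℝ) ^ (j + 1)) ^ 4) * dirSq (dirIter L (j + 1) (cavg L UB) X₀) (periodBox (d := d) N))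
    (hR3 : ∑ p ∈ perWin d (N * L ^ (j + 1)), ‖curl (cavg L UB) Nn p‖
      ≤ c₃ * (((L : ℝ) ^ (j + 1)) ^ d / ((L : ℝ) ^ (j + 1)) ^ 2) * dirL1 (dirIter L (j + 1) (cavg L UB) X₀) (periodBox (d := d) N))
    (hR4 : dirL1 Nn (periodBox (d := d) (N * L ^ (j + 1)))
      ≤ c₄ * (((L : ℝ) ^ (j + 1)) ^ d / (L : ℝ) ^ (j + 1)) * dirL1 (dirIter L (j + 1) (cavg L UB) X₀) (periodBox (d := d) N))
    -- k-free currencies of the pair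
    {αh Ch αNh aNh : ℝ} (hαh : α₀ * (L : ℝ) ^ (j + 1) ≤ αh) (hCh : C ≤ Ch) (hαNh : αN * (L : ℝ) ^ (j + 1) ≤ αNh)
    (haNh : aN * ((L : ℝ) ^ (j + 1)) ^ 2 ≤ aNh)
    -- uniform numeric lines
    (hℓ₁ : αh ≤ 1 / 100) (hℓ₂ : 4 * (3 + 12 * (d : ℝ)) ^ 2 * αh ≤ rho0 d L ^ 2) (hℓ₃ : αNh ≤ 1 / 2700) (hℓ₄ : 10 * (αh + 24 * αNh) ≤ 1)
    (hℓ₅ : 2 * (c₁ + c₂) * (4 * (3 + 12 * (d : ℝ)) ^ 3 / rho0 d L ^ 2) ^ 2 * Ch ^ 2 * αh ^ 2 ≤ 1 / 2)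
    -- the level lines, uniform form
    {Λ CP : ℝ} (hCP : 0 ≤ CP)
    (hJ1 : (1 + 480 * Real.sqrt d * (αh + 24 * αNh)) ^ 2
      + 48 * d * (3 * ε + 2 * aNh + 8192 * (αh + αNh) * αNh + 48 * αh ^ 2 + 1300 * ((αh + αNh) + (1 + 2048 * (αh + αNh)) * αNh) ^ 2) ≤ Λ)
    (hJ2 : 112 * (d : ℝ) * (3 * ε + 2 * aNh + 8192 * (αh + αNh) * αNh + 48 * αh ^ 2 + 1300 * ((αh + αNh) + (1 + 2048 * (αh + αNh)) * αNh) ^ 2)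
      * CP ≤ 1 / (2 * (Fintype.card n : ℝ))) :
    IsUnitaryCfg (cavg L UB) ∧
    ∃ (u' : Site d → (Matrix n n ℂ)ˣ) (X N' : Site d → Fin d → Matrix n n ℂ) (α αN' ν κ₁ κ₂ a : ℝ),
      DecomposedRep (sfClass d L N ε) L N (j + 1) V UA UB u' X N' α αN' ν κ₁ κ₂ a ∧
      ν ≤ (1 + 2048 * Real.sqrt (16 * d + 1)) * (2 * Real.sqrt (c₁ + c₂) * (4 * (3 + 12 * (d : ℝ)) ^ 3 / rho0 d L ^ 2)) * Ch * αh ∧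
      κ₁ ≤ (4 * c₃ + 32768 * d * c₄) * (4 * (3 + 12 * (d : ℝ)) ^ 3 / rho0 d L ^ 2) * Ch ^ 2
        * (3 * ε + 2 * aNh + 8192 * (αh + αNh) * αNh + 48 * αh ^ 2 + 1300 * ((αh + αNh) + (1 + 2048 * (αh + αNh)) * αNh) ^ 2) ∧
      κ₂ ≤ 7224 * c₄ * (4 * (3 + 12 * (d : ℝ)) ^ 3 / rho0 d L ^ 2) * Ch ^ 2
        * (3 * ε + 2 * aNh + 8192 * (αh + αNh) * αNh + 48 * αh ^ 2 + 1300 * ((αh + αNh) + (1 + 2048 * (αh + αNh)) * αNh) ^ 2) ∧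
      α ≤ 1 / 40 ∧ αN' ≤ 1 / 100 ∧
      (1 + 24 * Real.sqrt d * (Real.exp (10 * (α + αN')) - 1) * (L : ℝ) ^ (j + 1)) ^ 2 + 48 * d * a * ((L : ℝ) ^ (j + 1)) ^ 2 ≤ Λ ∧
      112 * (d : ℝ) * a * CP * ((L : ℝ) ^ (j + 1)) ^ 2 ≤ 1 / (2 * (Fintype.card n : ℝ)) := by
  have hL1 : 1 ≤ L := by omega
  have hL1r : (1 : ℝ) ≤ L := by exact_mod_cast hL1
  -- §1 data
  obtain ⟨-, hWu, hWP, hWx, hsm, hsmj, hA, hadmW, hxW⟩ := background_data hL hb hε hbs hbε' hsm1 hcurv j hUB.mem hreg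
  obtain ⟨hfib, hxA⟩ := fibre_and_window hL1 j hε hsmj hUA.mem hadmW h
  -- basic facts (no abbreviations: every expression stays raw so that `linarith` sees one atom per quantity)
  have hM1 : 1 ≤ (L : ℝ) ^ (j + 1) := one_le_pow₀ hL1r
  have hM0 : 0 < (L : ℝ) ^ (j + 1) := by positivity
  have hxM : ((L : ℝ) ^ (j + 1)) ^ 2 * (ε / ((L : ℝ) ^ (j + 1)) ^ 2) = ε := (levelRadius_rescale hL1 ε j).2
  have hρ0 : 0 < rho0 d L := rho0_pos (d := d) hL1
  have hα₀0 : 0 ≤ α₀ := h.hα₀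
  have hαh0 : 0 ≤ αh := le_trans (by positivity) hαh
  have hαNh0 : 0 ≤ αNh := le_trans (by positivity) hαNh
  have hx0 : 0 ≤ ε / ((L : ℝ) ^ (j + 1)) ^ 2 := by positivity
  -- the bare data are dominated by the currencies (`M ≥ 1`)
  have hα₀' : α₀ ≤ αh := (le_mul_of_one_le_right hα₀0 hM1).trans hαh
  have hαN' : αN ≤ αNh := (le_mul_of_one_le_right hαN0 hM1).trans hαNh
  -- the per-pair numeric inputs of the junction from the uniform lines
  have hα₀1 : α₀ ≤ 1 / 100 := hα₀'.trans hℓ₁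
  have hσ : 4 * (3 + 12 * (d : ℝ)) ^ 2 * (L : ℝ) ^ (j + 1) * α₀ ≤ rho0 d L ^ 2 := by
    have h1 : 4 * (3 + 12 * (d : ℝ)) ^ 2 * (α₀ * (L : ℝ) ^ (j + 1)) ≤ 4 * (3 + 12 * (d : ℝ)) ^ 2 * αh :=
      mul_le_mul_of_nonneg_left hαh (by positivity)
    linarith only [h1, hℓ₂]
  have hαN1 : αN ≤ 1 / 2700 := hαN'.trans hℓ₃
  have hJ1p : (α₀ + 43 * αN) * (L : ℝ) ^ (j + 1) ≤ 1 := by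
    have : (α₀ + 43 * αN) * (L : ℝ) ^ (j + 1) = α₀ * (L : ℝ) ^ (j + 1) + 43 * (αN * (L : ℝ) ^ (j + 1)) := by ring
    rw [this]; linarith only [hαh, hαNh, hℓ₁, hℓ₃]
  have hC2 : C ^ 2 ≤ Ch ^ 2 := pow_le_pow_left₀ hm.hC hCh 2
  have hρ : 2 * (c₁ + c₂) * (4 * (3 + 12 * (d : ℝ)) ^ 3 / rho0 d L ^ 2) ^ 2 * C ^ 2 * (α₀ * (L : ℝ) ^ (j + 1)) ^ 2 ≤ 1 / 2 := by
    have hK : 0 ≤ 2 * (c₁ + c₂) * (4 * (3 + 12 * (d : ℝ)) ^ 3 / rho0 d L ^ 2) ^ 2 := by positivity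
    have h2 : (α₀ * (L : ℝ) ^ (j + 1)) ^ 2 ≤ αh ^ 2 := pow_le_pow_left₀ (by positivity) hαh 2
    exact (dom_three hK (sq_nonneg C) hC2 (sq_nonneg _) h2).trans hℓ₅
  -- the junction
  have hD := decomposedRep_of_shapes (𝒞 := sfClass d L N ε) hL hN j hWu hWP hx0 hsm hWx hA hadmW h hα₀1 hσ hfib hm hmα
    hNP hαN0 hNsup hαN1 hJ1p haN haN0 hc₁ hc₂ hc₃ hc₄ hR1 hR2 hR3 hR4 hρ hx0 hx0 hxW hxA
  -- the radius of the junction and its k-free domination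
  have ha0 : 0 ≤ 2 * (ε / ((L : ℝ) ^ (j + 1)) ^ 2) + ε / ((L : ℝ) ^ (j + 1)) ^ 2 + 2 * aN + 4 * (2048 * (α₀ + αN) * αN)
      + 48 * α₀ ^ 2 + 1300 * ((α₀ + αN) + (1 + 2048 * (α₀ + αN)) * αN) ^ 2 := by positivity
  have haM := radius_dom (x := ε / ((L : ℝ) ^ (j + 1)) ^ 2) (aN := aN) (α₀ := α₀) (αN := αN) hM1 hα₀0 hαN0 hxM haNh hαh hαNh
  have haM0 : 0 ≤ (2 * (ε / ((L : ℝ) ^ (j + 1)) ^ 2) + ε / ((L : ℝ) ^ (j + 1)) ^ 2 + 2 * aN + 4 * (2048 * (α₀ + αN) * αN)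
      + 48 * α₀ ^ 2 + 1300 * ((α₀ + αN) + (1 + 2048 * (α₀ + αN)) * αN) ^ 2) * ((L : ℝ) ^ (j + 1)) ^ 2 :=
    mul_nonneg ha0 (by positivity)
  have hah0 : 0 ≤ 3 * ε + 2 * aNh + 8192 * (αh + αNh) * αNh + 48 * αh ^ 2 + 1300 * ((αh + αNh) + (1 + 2048 * (αh + αNh)) * αNh) ^ 2 :=
    haM0.trans haM
  refine ⟨hWu, u, _, _, _, _, _, _, _, _, hD, ?_, ?_, ?_, ?_, ?_, ?_, ?_⟩
  · -- ν
    have hK : 0 ≤ (1 + 2048 * Real.sqrt (16 * d + 1)) * (2 * Real.sqrt (c₁ + c₂) * (4 * (3 + 12 * (d : ℝ)) ^ 3 / rho0 d L ^ 2)) := by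
      positivity
    have h3 := dom_three hK hm.hC hCh (by positivity : (0:ℝ) ≤ α₀ * (L : ℝ) ^ (j + 1)) hαh
    linarith only [h3]
  · -- κ₁
    have hK : 0 ≤ (4 * c₃ + 32768 * d * c₄) * (4 * (3 + 12 * (d : ℝ)) ^ 3 / rho0 d L ^ 2) := by positivity
    have h3 := dom_three hK (sq_nonneg C) hC2 haM0 haM
    linarith only [h3]
  · -- κ₂
    have hK : 0 ≤ 7224 * c₄ * (4 * (3 + 12 * (d : ℝ)) ^ 3 / rho0 d L ^ 2) := by positivity
    have h3 := dom_three hK (sq_nonneg C) hC2 haM0 haM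
    linarith only [h3]
  · -- α = α₀ + αN ≤ 1∕40
    linarith only [hα₀1, hαN1]
  · -- αN' = (1 + 2048(α₀+αN))·αN ≤ 1∕100
    have hf : 1 + 2048 * (α₀ + αN) ≤ 23 := by linarith only [hα₀1, hαN1]
    have h1 : (1 + 2048 * (α₀ + αN)) * αN ≤ 23 * αN := mul_le_mul_of_nonneg_right hf hαN0
    linarith only [h1, hαN1]
  · -- (J1)
    have hf : 1 + 2048 * (α₀ + αN) ≤ 23 := by linarith only [hα₀1, hαN1]
    have hs0 : 0 ≤ (α₀ + αN) + (1 + 2048 * (α₀ + αN)) * αN := by positivity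
    have hsM : ((α₀ + αN) + (1 + 2048 * (α₀ + αN)) * αN) * (L : ℝ) ^ (j + 1) ≤ αh + 24 * αNh := by
      have h1 : (1 + 2048 * (α₀ + αN)) * (αN * (L : ℝ) ^ (j + 1)) ≤ 23 * αNh := mul_le_mul hf hαNh (by positivity) (by norm_num)
      linarith only [h1, hαh, hαNh]
    have hbr := exp_bracket_dom hM1 hs0 hsM hℓ₄
    have hbr0 : 0 ≤ (Real.exp (10 * ((α₀ + αN) + (1 + 2048 * (α₀ + αN)) * αN)) - 1) * (L : ℝ) ^ (j + 1) := by
      have := Real.one_le_exp (by positivity : (0:ℝ) ≤ 10 * ((α₀ + αN) + (1 + 2048 * (α₀ + αN)) * αN))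
      exact mul_nonneg (by linarith only [this]) hM0.le
    have hd0 : 0 ≤ Real.sqrt d := Real.sqrt_nonneg _
    have h1 : 24 * Real.sqrt d * ((Real.exp (10 * ((α₀ + αN) + (1 + 2048 * (α₀ + αN)) * αN)) - 1) * (L : ℝ) ^ (j + 1))
        ≤ 24 * Real.sqrt d * (20 * (αh + 24 * αNh)) := mul_le_mul_of_nonneg_left hbr (by positivity)
    have hl0 : 0 ≤ 1 + 24 * Real.sqrt d * (Real.exp (10 * ((α₀ + αN) + (1 + 2048 * (α₀ + αN)) * αN)) - 1) * (L : ℝ) ^ (j + 1) := by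
      have := mul_nonneg hd0 hbr0
      linarith only [this]
    have hle : 1 + 24 * Real.sqrt d * (Real.exp (10 * ((α₀ + αN) + (1 + 2048 * (α₀ + αN)) * αN)) - 1) * (L : ℝ) ^ (j + 1)
        ≤ 1 + 480 * Real.sqrt d * (αh + 24 * αNh) := by linarith only [h1]
    have hsq := pow_le_pow_left₀ hl0 hle 2
    have haM' := mul_le_mul_of_nonneg_left haM (by positivity : (0:ℝ) ≤ 48 * d)
    linarith only [hsq, haM', hJ1]
  · -- (J2)
    have h1 := mul_le_mul_of_nonneg_left haM (by positivity : (0:ℝ) ≤ 112 * (d : ℝ) * CP)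
    linarith only [h1, hJ2]

end

end Summit.QuantumFields.BalabanUV.T4Continuum.NE3DecomposedRepSfClass
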